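import Summits.BirchSwinnertonDyer.BirchSwinnertonDyer.Theorems.SylvesterTwoHeegnerIndexYinToricTransfer
import Mathlib.RingTheory.PrincipalIdealDomain
import HarnessLib

/-!
# Route `SylvesterTwoHeegnerIndex` (rung K7t): the INDEX SHIFT — under the toric trace relation with
# torsion anti-trace, `Y ∈ 2^{j+1}B(K) + tors ⟺ R ∈ 2^j B(L) + tors` for EVERY `j` («one factor of 2, exactly»)

HONEST FRAMING (cell b2b-bsdres, seat x1b GEN 54 = O12 class lead; file `--supports
stmt-BirchSwinnertonDyer-19891 --as helper`; closes no item; no mechanism, no definition, no named fact; no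
label moves; BSD is not claimed). Third file of the transfer family (x1b [166] `…YinToricTransfer`, [167]
`…YinToricTransferTwist`). bsd-cm-two MEMO v2.11 §54.2 reads the toric mechanism for `p ≡ 7 (9)` as «Yin's
`τ_r`-value is (minus, up to `μ₃`) the DOUBLE of the trace `R` of the `2`-conductor-`4` CM value», and §54.4
explains «why exactly one factor of `2`: a second factor would need `R ∈ 2V`». This file proves the exact
kernel form of both remarks, for every power of `2`:

* §1 abelian-group bookkeeping for «`x ∈ 2^j M + M_tors`» (`∃ S T, IsOfFinAddOrder T ∧ x = 2^j • S + T`):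
  odd multiples (Bézout `a·N + b·2^j = 1`, no `2`-torsion hypothesis needed), cancelling one factor `2`
  modulo torsion, transport along `→+` / `≃+`, negation, torsion shifts;
* §2 **DESCENT OF `2^j`-DIVISIBILITY** (`𝔽/K` finite Galois of characteristic `0`, `W/ℚ`, `W(𝔽)[2] = 0`):
  `N` odd and `N • ι Z − 2^j • S` torsion (`Z ∈ W(K)`, `S ∈ W(𝔽)`) ⟹ `Z = 2^j • Z′` in `W(K)` — x1b [161]/[162]'s
  descent layer (the case `j = 1`) for all `j`;
* §3 **THE INDEX SHIFT.** `L/K` finite Galois, `B/ℚ`, `B(L)[2] = 0`, `c : L ≃ₐ[K] L`, `θ` an additive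
  automorphism of `B(L)`, `N` odd, two's `TraceRelationAtTwo B K L c θ N Y R T` with `T` torsion AND two's
  `AntiTraceIsTorsion B K L c R` (the `p ≡ 7 (9)` situation: coherent toric period). THEN for every `j : ℕ`:
  «`Y = 2^{j+1} • Y′ + T″` in `B(K)`» ⟺ «`R = 2^j • S + T′` in `B(L)`» (`pow_succ_divisible_iff_trace_pow_divisible`).
  `j = 0` is two's THEOREM-C′ step (both sides hold); `j = 1` is §54.4 («`Y ∈ 4B(K) + tors ⟺ R ∈ 2B(L) + tors`»);
  in general the `2`-DIVISIBILITY INDEX of `Y` in `B(K)/tors` is EXACTLY one more than that of `R` in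
  `B(L)/tors` (`exactIndex_succ_iff_trace_exactIndex`). If moreover `Gal(L/K) = {1, c}` (two's binder), `R`
  descends: an odd multiple `m • R = ι R♭` with `R♭ ∈ B(K)`, and the shift reads inside `B(K)`:
  «`Y ∈ 2^{j+1}B(K) + tors ⟺ R♭ ∈ 2^j B(K) + tors`» (`exists_descendedTrace_index_shift`).

NET (record for the planner; no ask): with k7t-c2 g9's RUNG `cmAtTwo_iff_low_and_up_of_yin` (BSD₂ on the
Sylvester family ⟺ the `2`-divisibility index of Yin's point equals `ord₂ #Ш(E_p)[2^∞]/2 − δ`, `2δ = −2` for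
`p ≡ 7 (9)`) this says: GRANTED the toric data of stub (T) for the display point, BSD₂(E_p) for `p ≡ 7 (9)`
⟺ «the index of the descended trace `R♭` equals `ord₂ #Ш(E_p)[2^∞]/2`» — the SAME shape as for `p ≡ 4 (9)`
with `Z_p` (`δ = 0`): the residue-class asymmetry `δ` is exactly the factor `2` of the trace relation. In
particular the 𝒱₀-LOWER residual at `p ≡ 7 (9)` («`Y ∉ 4E_p(K) + tors`», k7t-c2 (low)) ⟺ «`R♭` is
`2`-PRIMITIVE in `E_p(K)/tors`». Nothing here is a mechanism for that primitivity. NO definition, NO named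
fact, NO sorry; axioms standard. References: MEMO-bsd-cm-two v2.11 §52.4 (C2), §54.2, §54.4; Silverman AEC
VIII.§1 (Galois descent).
-/

set_option autoImplicit false
-- the Summit-side namespace `Summit.BirchSwinnertonDyer.BirchSwinnertonDyer.…` (summit = problem) is mandated by D-0017
set_option linter.dupNamespace false

noncomputable section

open scoped Classical

open WeierstrassCurve WeierstrassCurve.Affine WeierstrassCurve.Affine.Point
open Summit.BirchSwinnertonDyer.BirchSwinnertonDyer.Theorems.SylvesterTwoYinToric
  Summit.BirchSwinnertonDyer.BirchSwinnertonDyer.Theorems.SylvesterTwoYinToricDescent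
  Literature.NumberTheory.EllipticCurves

namespace Summit.BirchSwinnertonDyer.BirchSwinnertonDyer.Theorems.SylvesterTwoYinToricTransfer

/-! ## §1 Bookkeeping for «`2^j`-divisible modulo torsion» -/

section Bookkeeping

variable {M M' : Type*} [AddCommGroup M] [AddCommGroup M']

/-- **An ODD multiple that is `2^j • W` is `2^j • Z′`** — Bézout: `a·N + b·2^j = 1`, so
`Z = a•(N•Z) + b•2^j•Z = 2^j • (a•W + b•Z)`. No hypothesis on `2`-torsion. [folklore] -/
theorem exists_eq_pow_two_smul_of_odd_smul_eq_pow_two_smul {N : ℤ} (hN : Odd N) (j : ℕ) {Z W : M}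
    (h : N • Z = ((2 : ℤ) ^ j) • W) : ∃ Z' : M, Z = ((2 : ℤ) ^ j) • Z' := by
  have h2 : IsCoprime (2 : ℤ) N := by
    rw [Prime.coprime_iff_not_dvd Int.prime_two]
    intro hdvd
    exact (Int.not_even_iff_odd.mpr hN) (even_iff_two_dvd.mpr hdvd)
  obtain ⟨a, b, hab⟩ := (h2.pow_left (m := j)).symm
  refine ⟨a • W + b • Z, ?_⟩
  calc Z = (a * N + b * (2 : ℤ) ^ j) • Z := by rw [hab, one_smul]
    _ = a • (N • Z) + ((2 : ℤ) ^ j) • (b • Z) := by rw [add_smul, mul_smul, mul_comm b, mul_smul]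
    _ = ((2 : ℤ) ^ j) • (a • W + b • Z) := by rw [h, smul_add, smul_comm a]

/-- Torsion version: `N` odd, `T` torsion, `N • Z = 2^j • W + T` ⟹ `Z = 2^j • Z′ + T′` with `T′` torsion
(`T′ = a • T`). [folklore] -/
theorem exists_eq_pow_two_smul_add_torsion_of_odd_smul {N : ℤ} (hN : Odd N) (j : ℕ) {Z W T : M}
    (hT : IsOfFinAddOrder T) (h : N • Z = ((2 : ℤ) ^ j) • W + T) :
    ∃ Z' T' : M, IsOfFinAddOrder T' ∧ Z = ((2 : ℤ) ^ j) • Z' + T' := by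
  have h2 : IsCoprime (2 : ℤ) N := by
    rw [Prime.coprime_iff_not_dvd Int.prime_two]
    intro hdvd
    exact (Int.not_even_iff_odd.mpr hN) (even_iff_two_dvd.mpr hdvd)
  obtain ⟨a, b, hab⟩ := (h2.pow_left (m := j)).symm
  refine ⟨a • W + b • Z, a • T, hT.zsmul, ?_⟩
  calc Z = (a * N + b * (2 : ℤ) ^ j) • Z := by rw [hab, one_smul]
    _ = a • (N • Z) + ((2 : ℤ) ^ j) • (b • Z) := by rw [add_smul, mul_smul, mul_comm b, mul_smul]
    _ = ((2 : ℤ) ^ j) • (a • W + b • Z) + a • T := by rw [h, smul_add, smul_add, smul_comm a]; abel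

/-- An ODD multiple does not change «`2^j`-divisible modulo torsion». [folklore] -/
theorem exists_eq_pow_two_smul_add_torsion_smul_iff_of_odd {N : ℤ} (hN : Odd N) (j : ℕ) (x : M) :
    (∃ S T : M, IsOfFinAddOrder T ∧ N • x = ((2 : ℤ) ^ j) • S + T) ↔
      ∃ S T : M, IsOfFinAddOrder T ∧ x = ((2 : ℤ) ^ j) • S + T := by
  constructor
  · rintro ⟨S, T, hT, h⟩
    exact exists_eq_pow_two_smul_add_torsion_of_odd_smul hN j hT h
  · rintro ⟨S, T, hT, h⟩
    exact ⟨N • S, N • T, hT.zsmul, by rw [h, smul_add, smul_comm]⟩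

/-- **Cancelling ONE factor `2` modulo torsion**: «`2 • x ∈ 2^{j+1} M + tors`» ⟺ «`x ∈ 2^j M + tors`»
(`2 • (x − 2^j • S)` torsion forces `x − 2^j • S` torsion; no hypothesis on `2`-torsion). [folklore] -/
theorem exists_eq_pow_two_smul_add_torsion_iff_two_smul (j : ℕ) (x : M) :
    (∃ S T : M, IsOfFinAddOrder T ∧ (2 : ℤ) • x = ((2 : ℤ) ^ (j + 1)) • S + T) ↔
      ∃ S T : M, IsOfFinAddOrder T ∧ x = ((2 : ℤ) ^ j) • S + T := by
  constructor
  · rintro ⟨S, T, hT, h⟩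
    have h2 : (2 : ℤ) • (x - ((2 : ℤ) ^ j) • S) = T := by
      rw [smul_sub, smul_smul, ← pow_succ', h, add_sub_cancel_left]
    have hD : IsOfFinAddOrder (x - ((2 : ℤ) ^ j) • S) := by
      obtain ⟨m, hm, hm0⟩ := hT.exists_nsmul_eq_zero
      refine isOfFinAddOrder_iff_nsmul_eq_zero.mpr ⟨m * 2, by positivity, ?_⟩
      rw [mul_nsmul', ← natCast_zsmul _ 2, Nat.cast_two, h2, hm0]
    exact ⟨S, x - ((2 : ℤ) ^ j) • S, hD, by abel⟩
  · rintro ⟨S, T, hT, h⟩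
    exact ⟨S, (2 : ℤ) • T, hT.zsmul, by rw [h, smul_add, smul_smul, ← pow_succ']⟩

/-- An additive map carries «`x = 2^j • S + T`, `T` torsion» to the same shape for `f x`. [folklore] -/
theorem exists_eq_pow_two_smul_add_torsion_map (f : M →+ M') (j : ℕ) {x : M}
    (h : ∃ S T : M, IsOfFinAddOrder T ∧ x = ((2 : ℤ) ^ j) • S + T) :
    ∃ S T : M', IsOfFinAddOrder T ∧ f x = ((2 : ℤ) ^ j) • S + T := by
  obtain ⟨S, T, hT, rfl⟩ := h
  exact ⟨f S, f T, f.isOfFinAddOrder hT, by rw [map_add, map_zsmul]⟩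

/-- Along an additive isomorphism, «`e x ∈ 2^j M′ + tors`» ⟺ «`x ∈ 2^j M + tors`». [folklore] -/
theorem exists_eq_pow_two_smul_add_torsion_iff_of_addEquiv (e : M ≃+ M') (j : ℕ) (x : M) :
    (∃ S T : M', IsOfFinAddOrder T ∧ e x = ((2 : ℤ) ^ j) • S + T) ↔
      ∃ S T : M, IsOfFinAddOrder T ∧ x = ((2 : ℤ) ^ j) • S + T := by
  refine ⟨fun h => ?_, exists_eq_pow_two_smul_add_torsion_map e.toAddMonoidHom j⟩
  have h' := exists_eq_pow_two_smul_add_torsion_map e.symm.toAddMonoidHom j h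
  simpa only [AddEquiv.toAddMonoidHom_eq_coe, AddMonoidHom.coe_coe, AddEquiv.symm_apply_apply] using h'

/-- «`−x ∈ 2^j M + tors`» ⟺ «`x ∈ 2^j M + tors`». [folklore] -/
theorem exists_eq_pow_two_smul_add_torsion_neg_iff (j : ℕ) (x : M) :
    (∃ S T : M, IsOfFinAddOrder T ∧ -x = ((2 : ℤ) ^ j) • S + T) ↔
      ∃ S T : M, IsOfFinAddOrder T ∧ x = ((2 : ℤ) ^ j) • S + T := by
  constructor
  · rintro ⟨S, T, hT, h⟩
    exact ⟨-S, -T, hT.neg, by rw [smul_neg, ← neg_add, ← h, neg_neg]⟩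
  · rintro ⟨S, T, hT, h⟩
    exact ⟨-S, -T, hT.neg, by rw [smul_neg, ← neg_add, ← h]⟩

/-- A torsion shift does not change «`2^j`-divisible modulo torsion». [folklore] -/
theorem exists_eq_pow_two_smul_add_torsion_add_iff (j : ℕ) {T₀ : M} (hT₀ : IsOfFinAddOrder T₀) (x : M) :
    (∃ S T : M, IsOfFinAddOrder T ∧ x + T₀ = ((2 : ℤ) ^ j) • S + T) ↔
      ∃ S T : M, IsOfFinAddOrder T ∧ x = ((2 : ℤ) ^ j) • S + T := by
  constructor
  · rintro ⟨S, T, hT, h⟩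
    exact ⟨S, T + -T₀, hT.add hT₀.neg, by rw [← add_assoc, ← h, add_neg_cancel_right]⟩
  · rintro ⟨S, T, hT, h⟩
    exact ⟨S, T + T₀, hT.add hT₀, by rw [h, add_assoc]⟩

end Bookkeeping

/-! ## §2 DESCENT of `2^j`-divisibility from `W(𝔽)` to `W(K)` -/

section Descent

variable {K : Type*} [Field K] [CharZero K] {F : Type*} [Field F] [CharZero F] [Algebra K F]
  (W : WeierstrassCurve ℚ)

/-- **DESCENT OF `2^j`-DIVISIBILITY.** `𝔽/K` finite Galois of characteristic `0`, `W/ℚ`, `W(𝔽)[2] = 0`,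
`Z ∈ W(K)`, `S ∈ W(𝔽)`, `N` odd, `N • ι Z − 2^j • S` TORSION ⟹ `Z = 2^j • Z′` in `W(K)`. (`σS − S` is killed
by `2^j` modulo torsion, hence torsion, hence of ODD order; `m • S` with `m = ∏_σ ord(σS − S)` is
Galois-fixed and descends to `Y₀ ∈ W(K)` (tree `exists_map_eq_of_forall_map_galois_eq`); then an odd multiple of
`Z` is `2^j • (n • Y₀)` in `W(K)` by injectivity of `ι`, and §1 concludes.) x1b [161]/[162] is `j = 1`.
[cite: SilvermanAEC2009, VIII.§1] -/
theorem exists_eq_pow_two_smul_of_smul_sub_torsion [IsGalois K F] [FiniteDimensional K F]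
    (h2 : ∀ T : (W.baseChange F).toAffine.Point, (2 : ℕ) • T = 0 → T = 0) (j : ℕ)
    {Z : (W.baseChange K).toAffine.Point} {S : (W.baseChange F).toAffine.Point} {N : ℤ} (hN : Odd N)
    (hZ : IsOfFinAddOrder (N • Affine.Point.map (algebraMap K F).toRatAlgHom Z - ((2 : ℤ) ^ j) • S)) :
    ∃ Z' : (W.baseChange K).toAffine.Point, Z = ((2 : ℤ) ^ j) • Z' := by
  set ι := Affine.Point.map (W' := W) (algebraMap K F).toRatAlgHom with hι
  set X := N • ι Z - ((2 : ℤ) ^ j) • S with hX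
  -- (i) `σS − S` is torsion for every `σ`
  have hS : ∀ σ : F ≃ₐ[K] F, IsOfFinAddOrder (Affine.Point.map (σ : F →ₐ[K] F) S - S) := by
    intro σ
    have e : ((2 : ℤ) ^ j) • (Affine.Point.map (σ : F →ₐ[K] F) S - S) =
        X + -Affine.Point.map (σ : F →ₐ[K] F) X := by
      rw [hX, map_sub, map_zsmul, map_zsmul, hι, map_galois_map_algebraMap, smul_sub]
      abel
    have hj : IsOfFinAddOrder (((2 : ℤ) ^ j) • (Affine.Point.map (σ : F →ₐ[K] F) S - S)) := by
      rw [e]; exact hZ.add ((Affine.Point.map (σ : F →ₐ[K] F)).isOfFinAddOrder hZ).neg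
    obtain ⟨m, hm, hm0⟩ := hj.exists_nsmul_eq_zero
    refine isOfFinAddOrder_iff_zsmul_eq_zero.mpr ⟨(m : ℤ) * (2 : ℤ) ^ j, ?_, ?_⟩
    · exact mul_ne_zero (by exact_mod_cast hm.ne') (pow_ne_zero _ two_ne_zero)
    · rw [mul_smul, natCast_zsmul, hm0]
  -- (ii) `m • S` is Galois-fixed with `m` odd, hence descends
  set m : ℕ := ∏ σ : F ≃ₐ[K] F, addOrderOf (Affine.Point.map (σ : F →ₐ[K] F) S - S) with hm
  have hmodd : Odd m :=
    Finset.prod_induction _ Odd (fun a b ha hb => ha.mul hb) odd_one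
      fun σ _ => odd_addOrderOf_of_forall_two_nsmul_eq_zero h2 (hS σ)
  have hfix : ∀ σ : F ≃ₐ[K] F, Affine.Point.map (σ : F →ₐ[K] F) (m • S) = m • S := by
    intro σ
    obtain ⟨k, hk⟩ : addOrderOf (Affine.Point.map (σ : F →ₐ[K] F) S - S) ∣ m :=
      Finset.dvd_prod_of_mem _ (Finset.mem_univ σ)
    have h0 : m • (Affine.Point.map (σ : F →ₐ[K] F) S - S) = 0 := by
      rw [hk, mul_nsmul, addOrderOf_nsmul_eq_zero, smul_zero]
    rw [smul_sub, sub_eq_zero, ← map_nsmul] at h0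
    exact h0
  obtain ⟨Y₀, hY₀⟩ := exists_map_eq_of_forall_map_galois_eq W hfix
  -- (iii) `n • X = 0` with `n` odd
  set n : ℕ := addOrderOf X with hn
  have hnodd : Odd n := odd_addOrderOf_of_forall_two_nsmul_eq_zero h2 hZ
  have hnX : n • X = 0 := addOrderOf_nsmul_eq_zero X
  -- (iv) `(n m N) • Z = 2^j • ((n m) • Y₀)` in `W(K)` by injectivity of `ι`
  have hinj : Function.Injective ι := Affine.Point.map_injective _
  have key : (((n * m : ℕ) : ℤ) * N) • Z = ((2 : ℤ) ^ j) • ((n : ℤ) • Y₀) := by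
    apply hinj
    have e1 : ((n : ℤ) * N) • ι Z = ((n : ℤ) * (2 : ℤ) ^ j) • S := by
      have h' := hnX
      rw [hX, smul_sub, sub_eq_zero, ← natCast_zsmul, smul_smul, ← natCast_zsmul, smul_smul] at h'
      exact h'
    rw [map_zsmul, map_zsmul, map_zsmul, hY₀, Nat.cast_mul, ← natCast_zsmul S m]
    rw [show ((n : ℤ) * (m : ℤ) * N) • ι Z = (m : ℤ) • (((n : ℤ) * N) • ι Z) by
      rw [smul_smul]; congr 1; ring]
    rw [e1]
    simp only [smul_smul]
    congr 1
    ring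
  have hodd : Odd (((n * m : ℕ) : ℤ) * N) := (Int.odd_coe_nat _ |>.mpr (hnodd.mul hmodd)).mul hN
  exact exists_eq_pow_two_smul_of_odd_smul_eq_pow_two_smul hodd j key

/-- The same in the «modulo torsion» currency: `N • ι Z = 2^j • S + T₁` with `T₁` torsion ⟹
`Z = 2^j • Z′ + T′` in `W(K)` (here `T′ = 0`). [cite: SilvermanAEC2009, VIII.§1] -/
theorem exists_eq_pow_two_smul_add_torsion_of_smul_eq [IsGalois K F] [FiniteDimensional K F]
    (h2 : ∀ T : (W.baseChange F).toAffine.Point, (2 : ℕ) • T = 0 → T = 0) (j : ℕ)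
    {Z : (W.baseChange K).toAffine.Point} {S T₁ : (W.baseChange F).toAffine.Point} {N : ℤ} (hN : Odd N)
    (hT₁ : IsOfFinAddOrder T₁)
    (hZ : N • Affine.Point.map (algebraMap K F).toRatAlgHom Z = ((2 : ℤ) ^ j) • S + T₁) :
    ∃ Z' T' : (W.baseChange K).toAffine.Point, IsOfFinAddOrder T' ∧ Z = ((2 : ℤ) ^ j) • Z' + T' := by
  obtain ⟨Z', hZ'⟩ := exists_eq_pow_two_smul_of_smul_sub_torsion W h2 j hN (S := S)
    (by rw [hZ, add_sub_cancel_left]; exact hT₁)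
  exact ⟨Z', 0, IsOfFinAddOrder.zero, by rw [hZ', add_zero]⟩

/-- **`2^j`-divisibility modulo torsion is the same in `W(K)` and in `W(𝔽)`** (for the image `ι Z` of a
`K`-point; `𝔽/K` finite Galois, `W(𝔽)[2] = 0`). [cite: SilvermanAEC2009, VIII.§1] -/
theorem exists_eq_pow_two_smul_add_torsion_map_iff [IsGalois K F] [FiniteDimensional K F]
    (h2 : ∀ T : (W.baseChange F).toAffine.Point, (2 : ℕ) • T = 0 → T = 0) (j : ℕ)
    (Z : (W.baseChange K).toAffine.Point) :
    (∃ S T : (W.baseChange F).toAffine.Point, IsOfFinAddOrder T ∧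
        Affine.Point.map (algebraMap K F).toRatAlgHom Z = ((2 : ℤ) ^ j) • S + T) ↔
      ∃ Z' T' : (W.baseChange K).toAffine.Point, IsOfFinAddOrder T' ∧ Z = ((2 : ℤ) ^ j) • Z' + T' := by
  refine ⟨fun ⟨S, T, hT, h⟩ => ?_,
    exists_eq_pow_two_smul_add_torsion_map (Affine.Point.map (algebraMap K F).toRatAlgHom) j⟩
  exact exists_eq_pow_two_smul_add_torsion_of_smul_eq W h2 j odd_one hT (by rw [one_smul, h])

end Descent

/-! ## §3 THE INDEX SHIFT under the trace relation with torsion anti-trace -/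

section IndexShift

-- `K L : Type`: bsd-cm-two's `TraceRelationAtTwo` / `AntiTraceIsTorsion` are stated over `Type`
variable {K L : Type} [Field K] [CharZero K] [Field L] [CharZero L] [Algebra K L]
  (B : WeierstrassCurve ℚ)

/-- The trace relation with torsion anti-trace in the shape «`N • ι Y = 2 • (−θ R) + T₁`, `T₁` torsion»:
`R + cR = 2•R − (R − cR)`. [folklore] -/
theorem trace_eq_two_smul_add_torsion_of_antiTrace (c : L ≃ₐ[K] L)
    (θ : (B.baseChange L).toAffine.Point →+ (B.baseChange L).toAffine.Point) (N : ℤ)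
    {Y : (B.baseChange K).toAffine.Point} {R T : (B.baseChange L).toAffine.Point}
    (hT : IsOfFinAddOrder T) (htrace : TraceRelationAtTwo B K L c θ N Y R T)
    (hanti : AntiTraceIsTorsion B K L c R) :
    ∃ T₁ : (B.baseChange L).toAffine.Point, IsOfFinAddOrder T₁ ∧
      N • Affine.Point.baseChange (W' := B) K L Y = (2 : ℤ) • (-(θ R)) + T₁ := by
  refine ⟨θ (R - Affine.Point.map (W' := B) (c : L →ₐ[K] L) R) + T,
    (θ.isOfFinAddOrder hanti).add hT, ?_⟩
  rw [htrace]
  have e : R + Affine.Point.map (W' := B) (c : L →ₐ[K] L) R =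
      (2 : ℤ) • R - (R - Affine.Point.map (W' := B) (c : L →ₐ[K] L) R) := by rw [two_smul]; abel
  rw [e, map_sub θ ((2 : ℤ) • R), map_zsmul, smul_neg]
  abel

/-- **THE INDEX SHIFT (MEMO-bsd-cm-two v2.11 §54.2 / §54.4, kernel, all powers of `2`).** `L/K` finite
Galois of characteristic `0`, `B/ℚ` with `B(L)[2] = 0`, `c : L ≃ₐ[K] L`, `θ` an additive automorphism of
`B(L)`, `N` odd, the trace relation `N • ι Y = −θ(R + cR) + T` (`TraceRelationAtTwo`) with `T` torsion and the
anti-trace `R − cR` torsion (`AntiTraceIsTorsion`). THEN for every `j`: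
«`Y = 2^{j+1} • Y′ + T″` in `B(K)`» ⟺ «`R = 2^j • S + T′` in `B(L)`».
`j = 0`: both sides hold (two's THEOREM-C′ step p503775); `j = 1`: «a second factor of `2` for `Y` ⟺
`R ∈ 2B(L) + tors`» (§54.4). [cite: SilvermanAEC2009, VIII.§1] -/
theorem pow_succ_divisible_iff_trace_pow_divisible [IsGalois K L] [FiniteDimensional K L]
    (hL2 : ∀ Q : (B.baseChange L).toAffine.Point, (2 : ℕ) • Q = 0 → Q = 0) (c : L ≃ₐ[K] L)
    (θ : (B.baseChange L).toAffine.Point ≃+ (B.baseChange L).toAffine.Point) {N : ℤ} (hN : Odd N)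
    {Y : (B.baseChange K).toAffine.Point} {R T : (B.baseChange L).toAffine.Point}
    (hT : IsOfFinAddOrder T) (htrace : TraceRelationAtTwo B K L c (θ : _ →+ _) N Y R T)
    (hanti : AntiTraceIsTorsion B K L c R) (j : ℕ) :
    (∃ Y' T'' : (B.baseChange K).toAffine.Point, IsOfFinAddOrder T'' ∧ Y = ((2 : ℤ) ^ (j + 1)) • Y' + T'') ↔
      ∃ S T' : (B.baseChange L).toAffine.Point, IsOfFinAddOrder T' ∧ R = ((2 : ℤ) ^ j) • S + T' := by
  obtain ⟨T₁, hT₁, h1⟩ := trace_eq_two_smul_add_torsion_of_antiTrace B c (θ : _ →+ _) N hT htrace hanti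
  set ι : (B.baseChange K).toAffine.Point →+ (B.baseChange L).toAffine.Point :=
    Affine.Point.baseChange (W' := B) K L with hι
  -- `Y`-side ⟺ `ι Y`-side (descent) ⟺ `N • ι Y`-side (odd multiple)
  have step1 : (∃ Y' T'' : (B.baseChange K).toAffine.Point, IsOfFinAddOrder T'' ∧
      Y = ((2 : ℤ) ^ (j + 1)) • Y' + T'') ↔
      ∃ S T' : (B.baseChange L).toAffine.Point, IsOfFinAddOrder T' ∧
        N • ι Y = ((2 : ℤ) ^ (j + 1)) • S + T' := by
    rw [exists_eq_pow_two_smul_add_torsion_smul_iff_of_odd hN, hι,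
      ← map_toRatAlgHom_eq_baseChange, exists_eq_pow_two_smul_add_torsion_map_iff B hL2]
  -- `N • ι Y = 2 • (−θ R) + T₁`: shift the torsion, cancel one `2`, remove `−θ`
  rw [step1, h1, exists_eq_pow_two_smul_add_torsion_add_iff (j + 1) hT₁,
    exists_eq_pow_two_smul_add_torsion_iff_two_smul, exists_eq_pow_two_smul_add_torsion_neg_iff]
  simp only [AddMonoidHom.coe_coe]
  exact exists_eq_pow_two_smul_add_torsion_iff_of_addEquiv θ j R

/-- **EXACT INDICES SHIFT BY ONE.** Same hypotheses: for every `j`, «`Y ∈ 2^{j+1}B(K) + tors` and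
`Y ∉ 2^{j+2}B(K) + tors`» ⟺ «`R ∈ 2^j B(L) + tors` and `R ∉ 2^{j+1}B(L) + tors`» — the `2`-divisibility index of
`Y` in `B(K)/tors` is exactly one more than that of `R` in `B(L)/tors` (memo §54.2: Yin's value is the DOUBLE
of the trace of the `2`-conductor-`4` CM value). [cite: SilvermanAEC2009, VIII.§1] -/
theorem exactIndex_succ_iff_trace_exactIndex [IsGalois K L] [FiniteDimensional K L]
    (hL2 : ∀ Q : (B.baseChange L).toAffine.Point, (2 : ℕ) • Q = 0 → Q = 0) (c : L ≃ₐ[K] L)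
    (θ : (B.baseChange L).toAffine.Point ≃+ (B.baseChange L).toAffine.Point) {N : ℤ} (hN : Odd N)
    {Y : (B.baseChange K).toAffine.Point} {R T : (B.baseChange L).toAffine.Point}
    (hT : IsOfFinAddOrder T) (htrace : TraceRelationAtTwo B K L c (θ : _ →+ _) N Y R T)
    (hanti : AntiTraceIsTorsion B K L c R) (j : ℕ) :
    ((∃ Y' T'' : (B.baseChange K).toAffine.Point, IsOfFinAddOrder T'' ∧ Y = ((2 : ℤ) ^ (j + 1)) • Y' + T'') ∧
      ¬ ∃ Y' T'' : (B.baseChange K).toAffine.Point, IsOfFinAddOrder T'' ∧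
        Y = ((2 : ℤ) ^ (j + 2)) • Y' + T'') ↔
    ((∃ S T' : (B.baseChange L).toAffine.Point, IsOfFinAddOrder T' ∧ R = ((2 : ℤ) ^ j) • S + T') ∧
      ¬ ∃ S T' : (B.baseChange L).toAffine.Point, IsOfFinAddOrder T' ∧ R = ((2 : ℤ) ^ (j + 1)) • S + T') := by
  rw [pow_succ_divisible_iff_trace_pow_divisible B hL2 c θ hN hT htrace hanti j,
    pow_succ_divisible_iff_trace_pow_divisible B hL2 c θ hN hT htrace hanti (j + 1)]

/-- **THE TRACE DESCENDS** when `Gal(L/K) = {1, c}` and the anti-trace is torsion: an ODD multiple of `R` is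
`ι R♭` with `R♭ ∈ B(K)` (`σR − R` is torsion for `σ ∈ {1, c}`, of odd order since `B(L)[2] = 0`; an odd
multiple of `R` is Galois-fixed and descends, tree `exists_map_eq_of_forall_map_galois_eq`).
[cite: SilvermanAEC2009, VIII.§1] -/
theorem exists_descendedTrace [IsGalois K L] [FiniteDimensional K L]
    (hL2 : ∀ Q : (B.baseChange L).toAffine.Point, (2 : ℕ) • Q = 0 → Q = 0) (c : L ≃ₐ[K] L)
    (hGal : ∀ σ : L ≃ₐ[K] L, σ = AlgEquiv.refl ∨ σ = c) {R : (B.baseChange L).toAffine.Point}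
    (hanti : AntiTraceIsTorsion B K L c R) :
    ∃ (Rf : (B.baseChange K).toAffine.Point) (m : ℕ), Odd m ∧
      Affine.Point.baseChange (W' := B) K L Rf = m • R := by
  have hσ : ∀ σ : L ≃ₐ[K] L, IsOfFinAddOrder (Affine.Point.map (W' := B) (σ : L →ₐ[K] L) R - R) := by
    intro σ
    rcases hGal σ with h | h
    · rw [h]
      have : Affine.Point.map (W' := B) ((AlgEquiv.refl : L ≃ₐ[K] L) : L →ₐ[K] L) R = R := by
        rcases R with _ | ⟨x, y, h⟩ <;> rfl
      rw [this, sub_self]; exact IsOfFinAddOrder.zero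
    · rw [h]
      have e : Affine.Point.map (W' := B) (c : L →ₐ[K] L) R - R =
          -(R - Affine.Point.map (W' := B) (c : L →ₐ[K] L) R) := by abel
      rw [e]; exact hanti.neg
  set m : ℕ := ∏ σ : L ≃ₐ[K] L, addOrderOf (Affine.Point.map (W' := B) (σ : L →ₐ[K] L) R - R) with hm
  have hmodd : Odd m :=
    Finset.prod_induction _ Odd (fun a b ha hb => ha.mul hb) odd_one
      fun σ _ => odd_addOrderOf_of_forall_two_nsmul_eq_zero hL2 (hσ σ)
  have hfix : ∀ σ : L ≃ₐ[K] L, Affine.Point.map (W' := B) (σ : L →ₐ[K] L) (m • R) = m • R := by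
    intro σ
    obtain ⟨k, hk⟩ : addOrderOf (Affine.Point.map (W' := B) (σ : L →ₐ[K] L) R - R) ∣ m :=
      Finset.dvd_prod_of_mem _ (Finset.mem_univ σ)
    have h0 : m • (Affine.Point.map (W' := B) (σ : L →ₐ[K] L) R - R) = 0 := by
      rw [hk, mul_nsmul, addOrderOf_nsmul_eq_zero, smul_zero]
    rw [smul_sub, sub_eq_zero, ← map_nsmul] at h0
    exact h0
  obtain ⟨Rf, hRf⟩ := exists_map_eq_of_forall_map_galois_eq B hfix
  exact ⟨Rf, m, hmodd, by rw [← map_toRatAlgHom_eq_baseChange, hRf]⟩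

/-- **THE INDEX SHIFT INSIDE `B(K)`** (two's binder situation `Gal(L/K) = {1, c}`). `L/K` finite Galois,
`Gal(L/K) = {1, c}`, `B(L)[2] = 0`, `θ` an additive automorphism, `N` odd, `TraceRelationAtTwo B K L c θ N Y R T`,
`T` torsion, `AntiTraceIsTorsion B K L c R`. THEN there is a DESCENDED TRACE `R♭ ∈ B(K)` (`ι R♭ = m • R`, `m` odd)
and for every `j`: «`Y ∈ 2^{j+1}B(K) + tors`» ⟺ «`R♭ ∈ 2^j B(K) + tors`». With k7t-c2 g9's RUNG
(`cmAtTwo_iff_low_and_up_of_yin`, `2δ = −2` at `p ≡ 7 (9)`): granted stub (T)'s toric data for the display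
point, BSD₂(E_p) at `p ≡ 7 (9)` ⟺ «index of `R♭` = `ord₂ #Ш(E_p)[2^∞]/2`» — the `p ≡ 4 (9)` shape with `R♭`
in place of `Z_p`; the 𝒱₀-LOWER residual «`Y ∉ 4E_p(K) + tors`» ⟺ «`R♭` is `2`-primitive».
[cite: SilvermanAEC2009, VIII.§1] -/
theorem exists_descendedTrace_index_shift [IsGalois K L] [FiniteDimensional K L]
    (hL2 : ∀ Q : (B.baseChange L).toAffine.Point, (2 : ℕ) • Q = 0 → Q = 0) (c : L ≃ₐ[K] L)
    (hGal : ∀ σ : L ≃ₐ[K] L, σ = AlgEquiv.refl ∨ σ = c)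
    (θ : (B.baseChange L).toAffine.Point ≃+ (B.baseChange L).toAffine.Point) {N : ℤ} (hN : Odd N)
    {Y : (B.baseChange K).toAffine.Point} {R T : (B.baseChange L).toAffine.Point}
    (hT : IsOfFinAddOrder T) (htrace : TraceRelationAtTwo B K L c (θ : _ →+ _) N Y R T)
    (hanti : AntiTraceIsTorsion B K L c R) :
    ∃ (Rf : (B.baseChange K).toAffine.Point) (m : ℕ), Odd m ∧
      Affine.Point.baseChange (W' := B) K L Rf = m • R ∧
      ∀ j : ℕ,
        ((∃ Y' T'' : (B.baseChange K).toAffine.Point, IsOfFinAddOrder T'' ∧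
            Y = ((2 : ℤ) ^ (j + 1)) • Y' + T'') ↔
          ∃ S T' : (B.baseChange K).toAffine.Point, IsOfFinAddOrder T' ∧ Rf = ((2 : ℤ) ^ j) • S + T') := by
  obtain ⟨Rf, m, hm, hRf⟩ := exists_descendedTrace B hL2 c hGal hanti
  refine ⟨Rf, m, hm, hRf, fun j => ?_⟩
  rw [pow_succ_divisible_iff_trace_pow_divisible B hL2 c θ hN hT htrace hanti j]
  -- `R`-side in `B(L)` ⟺ `m • R`-side ⟺ `ι Rf`-side ⟺ `Rf`-side in `B(K)`
  have hmZ : Odd (m : ℤ) := (Int.odd_coe_nat m).mpr hm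
  rw [← exists_eq_pow_two_smul_add_torsion_smul_iff_of_odd hmZ j R, natCast_zsmul, ← hRf,
    ← map_toRatAlgHom_eq_baseChange, exists_eq_pow_two_smul_add_torsion_map_iff B hL2]

end IndexShift

end Summit.BirchSwinnertonDyer.BirchSwinnertonDyer.Theorems.SylvesterTwoYinToricTransfer

end
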